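/-
Copyright (c) 2026 the pub-hodgecm-mathlib formalisation cell (harness21).  Prover seat hodgecm-mathlib-K2E4-p11 (g7): Track B «K2-LIT»,
#184♮ = hLiu418 = stmt-HodgeConjecture-24832; Road Φ of socket #41, Φ9 consumer sheet ROW G2 — the per-place glue (LEAD F0P6-plan (g14) BATCH #47 (1),
desk K2Liu-p12 (g4) spec 2026-09-04T15:03:44Z), file 2 of 2: the CM print on `N_Δ(L⁺_v) = unipDeltaLoc v` — row G1's local factor at a good unimodular place.
-/
import Summits.HodgeConjecture.HodgeConjecture.Theorems.K2LiuGoodPlaceWhittakerSkewValue     -- ★ file 1 (this seat): `integral_whittaker_eq_of_parity_inert∕_split` (whole Skew integral = μ(B 0)·(1−q^{−(2s+1)})(1−α q^{−(2s+2)}))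
import Summits.HodgeConjecture.HodgeConjecture.Theorems.K2LiuLocalWhittakerFactorSkew        -- ★ B4 (K2Liu-p12): `integral_unipDeltaLoc_eq_integral_skew_addChar`; brings ★ B1 `mem_unipDeltaLoc_iff_mem_unipDeltaLocal`, ★ B2 Haar transport
import Summits.HodgeConjecture.HodgeConjecture.Theorems.K2LiuSphericalSectionLambdaLoc       -- ★ (4c) (K2Liu-p01): `isSphericalSection_lambdaLoc` (`Λ_{s,v}` spherical for every `s`)
import Summits.HodgeConjecture.HodgeConjecture.Theorems.K2E1QuadraticHeckeCharCMPlaceValues   -- ★ parity dictionary: `valueAtUniformizer_quadraticHeckeCharCM_of_nonsplit∕_of_split`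
import HarnessLib

/-!
# Crux `HLiu418`, Road Φ of socket #41, ROW G2's PER-PLACE GLUE, FILE 2 — `K2LiuGoodPlaceLocalFactor`: AT A GOOD UNIMODULAR PLACE
# `∫_{N_Δ(L⁺_v)} conj ψ_S(ι_v y)·Λ_{s,v}((w_Δ)_v y) dν_v = ν_v(N_Δ(L⁺_v) ∩ K_{H,v}) · (1 − q_v^{−(2s+1)})(1 − ε(ϖ_v) q_v^{−(2s+2)})`

Cell `hodgecm-mathlib`, crux item hLiu418 = `stmt-HodgeConjecture-24832`, route of record `HCCMUnconditional`; squad K2 ∕ K2Liu, road `K2_Liu`,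
socket #41 `sig_K2LiuSiegelEisensteinContinuation`, Road Φ; Φ9 consumer sheet row G2 (desk K2Liu-p12 (g4) 15:03:44Z bytes: «= EXACTLY ★ (b) `hasProd_whittaker_div_vol`'s
letter `hW` with `m v := ν_v.real (N_Δ ∩ K_v)`; assembly of ★ only: ★ B4 + ★ B3 `hΨ` → ★ Φ5-tie (`hshell` = ★ Φ4 (i), `hint`) → ★ E7 + ★ B2 + the letter discharges»).
THEOREMS ONLY (no `def`, no `instance`, no `notation`, no named-fact hypothesis, no `sorry`); lane `--supports stmt-HodgeConjecture-24832 --as helper` (count-neutral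
helper; closes no socket by itself).

THE MATHEMATICS [Shimura1997, §18.1 (18.4)], [Liu2011, §2A (2-10)], [Casselman1980, §3].  K2Lit CM frame: `L` CM, `H = U(hermD)` the doubled unitary group of the
hermitian datum `(e, dV, dW)` with `n = 2`, `v` a finite place of `L⁺ = Fp L`, `N_Δ(L⁺_v) = unipDeltaLoc v` with a Haar measure `ν`, the coordinate homeomorphism
`ψc : N_Δ(L⁺_v) ≃ₜ Skew` (`(ψc u).1 = B(matA u)`, ★ B2), the unramified Hecke character `χ` and its spherical sections `Λ_{s,v} =` ★ `LambdaLoc` (★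
`isSphericalSection_lambdaLoc`, every `s`), a Fourier index `S ∈ M₂(L)` integral and unimodular above `v` (`β := −⅟2·(S ⊗ 1)`, the index of ★ B4).  Then ★ B4 turns row G1's
local factor into the whole Skew-carrier Whittaker integral against `ψc_*ν` (letter `hΨ`, ★ B3 by value), ★ file 1 evaluates it (★ Φ4 (i) ∕ ★ Φ5-tie ∕ ★ E7), ★ B2
`measureReal_map_ball_zero_eq` reads `(ψc_*ν)(B(0)) = ν(N_Δ ∩ K_v)`, and the parity dictionary ★ `valueAtUniformizer_quadraticHeckeCharCM_of_nonsplit∕_of_split` turns the parity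
letter `∏_{w∣v} χ_w(ι_w ϖ) = ε(ϖ_v)` (`ε = quadraticHeckeCharCM L`) into ★ E7's `α = ∓1` at an inert ∕ split `w₀ ∣ v`.
* §1 HEAD **`integral_unipDeltaLoc_lambdaLoc_eq`** — the displayed identity, in the `(1 − ε(ϖ_v) q_v^{−(2s+2)})` currency of ★ G1 `hasProd_whittaker_div_vol`'s `hW`
  (`W v :=` the left-hand side, `m v := ν.real (N_Δ ∩ K_v)`).
* §1 `skewCarrier_measure_letters` (★ B2 ×3, packed); `skew_integral_lambdaLoc_eq_of_parity_inert ∕ _split` (★ file 1 in the CM frame at `μ := ψc_*ν`) and `integral_unipDeltaLoc_lambdaLoc_eq_of_parity_inert ∕ _split`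
  (★ B4 ∘ those ∘ ★ B2) — the same with ★ E7's raw parity letter `α = −1 ∕ 1` (no dictionary, no `hunr`).
VISIBLE LETTERS (hypothesis-first, by value): the good-place letters of ★ E7's `Heads` block read at `T₀ := gramR`, `δ := imagUnit L`, `χ_w := χ.localComponent w` (`hπ hπw h2v hT
hTinv hTb hTib hχur hϖ0 hdψ hτ hτadd hτs hτc h2F hεσ hεint hε h2 hδu`), the index letters (`hβs hββ hβ0 hβinv0` for `β = −⅟2·(S ⊗ 1)`), `hdV0 hdW0` (`det gramR` a unit), B3's
`hΨ`, B2's `ψc ∕ hψc`, the integrability `hint` of the Skew-carrier integrand against `ψc_*ν` (★ `K2LiuSiegelIntertwiningIntegrable.integrable_weylDelta_mul` on `1 < re s` pays it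
after the B1∕B2 transport — next edition), the unramifiedness `hχ ∕ hunr`, and the PARITY letter `hα : ∏_{w∣v} χ_w(ι_w ϖ) = ε(ϖ_v)` (`χ|_{𝔸_{L⁺}^×} = ε`, ★ `IsSplittingChar`; G1∕Φ3d's
letter).
HONEST LABEL.  Count-neutral helper; it retires nothing by itself: `HC_CM` is proved only modulo the 7 printed citations (2 remaining named inputs:
hLiu418 = `stmt-HodgeConjecture-24832`, h413 = `stmt-HodgeConjecture-24833`) until rung 0 closes.

## References
* [Shimura1997] G. Shimura, *Euler products and Eisenstein series*, CBMS 93 (1997): §18.1 (18.4), §18.3.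
* [Liu2011] Y. Liu, *Arithmetic theta lifting and L-derivatives for unitary groups, I*, Algebra Number Theory 5 (2011): §2A p. 936 (2-10).
* [Casselman1980] W. Casselman, Compositio Math. 40 (1980), §3.   * [KudlaRallis1994] S. Kudla, S. Rallis, Ann. of Math. 140 (1994), §1–§2.
* [HarrisKudlaSweet1996] M. Harris, S. Kudla, W. J. Sweet, J. AMS 9 (1996): §1 (1.11)–(1.12), §6 (6.16).   * [Weil1965] A. Weil, *L'intégration…* (1965), §37.
-/

set_option autoImplicit false
-- the mandated namespace repeats the single-problem summit's segment (`HodgeConjecture.HodgeConjecture`)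
set_option linter.dupNamespace false

noncomputable section

open scoped Matrix ComplexConjugate NNReal ENNReal
open NumberField IsDedekindDomain Matrix MeasureTheory Set
open Literature.NumberTheory.Automorphic Literature.NumberTheory.Automorphic.UnitaryGroup Literature.NumberTheory.GaloisRepresentations
open Literature.NumberTheory.GaloisRepresentations.IsNonarchimedeanLocalField
open Literature.NumberTheory.GelbartRogawski1991 Literature.NumberTheory.GelbartRogawski1991.GRConstruction
open Literature.NumberTheory.GelbartRogawski1991.AdaptedBlocks
open Literature.NumberTheory.GelbartRogawski1991.UnitaryDualPair Literature.NumberTheory.GelbartRogawski1991.UnitaryDualPair.LocalSplitting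
open Literature.NumberTheory.K2Lit Literature.NumberTheory.K2Lit.SiegelDoubled Literature.NumberTheory.K2Lit.LocalSiegelDoubled
open Summit.HodgeConjecture.HodgeConjecture.Cruxes.HLiu418.K2LiuSiegelUnipotentFourierDefs
open Summit.HodgeConjecture.HodgeConjecture.Cruxes.HLiu418.K2LiuSiegelUnipotentLocalDefs
open Summit.HodgeConjecture.HodgeConjecture.Cruxes.HLiu418.K2LiuUnipDeltaLocBridge
open Summit.HodgeConjecture.HodgeConjecture.Cruxes.HLiu418.K2LiuUnipDeltaLocalHaarTransport
open Summit.HodgeConjecture.HodgeConjecture.Cruxes.HLiu418.K2LiuLocalWhittakerFactorSkew (integral_unipDeltaLoc_eq_integral_skew_addChar)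
open Summit.HodgeConjecture.HodgeConjecture.Cruxes.HLiu418.K2LiuGoodPlaceWhittakerSkewValue (integral_whittaker_eq_of_parity_inert integral_whittaker_eq_of_parity_split)
open Summit.HodgeConjecture.HodgeConjecture.Cruxes.HLiu418.K2LiuSphericalSectionLambdaLoc (isSphericalSection_lambdaLoc)
open Summit.HodgeConjecture.HodgeConjecture.Cruxes.H413.K2E1QuadraticHeckeCharCMPlaceValues (valueAtUniformizer_quadraticHeckeCharCM_of_nonsplit valueAtUniformizer_quadraticHeckeCharCM_of_split)

namespace Summit.HodgeConjecture.HodgeConjecture.Cruxes.HLiu418.K2LiuGoodPlaceLocalFactor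

variable (L : Type) [Field L] [NumberField L] [IsCMField L]
variable {N M : ℕ} (e : Fin N × Fin M ≃ Fin 2)
  (dV : Fin N → L) (hdV : ∀ i, IsCMField.complexConj L (dV i) = dV i)
  (dW : Fin M → L) (hdW : ∀ i, IsCMField.complexConj L (dW i) = dW i)
  (hdV0 : ∀ i, dV i ≠ 0) (hdW0 : ∀ i, dW i ≠ 0)
  (v : HeightOneSpectrum (𝓞 (Fp L)))
  {π : v.adicCompletion (Fp L)} (hπ : Valued.v π = WithZero.exp (-1 : ℤ))
  (hπw : ∀ w : UnitaryGroup.PlacesOver L v, Valued.v (toPlace v w π) = WithZero.exp (-1 : ℤ))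

variable [MeasurableSpace ↥(unipDeltaLoc L e dV hdV dW hdW v)] [BorelSpace ↥(unipDeltaLoc L e dV hdV dW hdW v)]
  (Sk : AddSubgroup (Matrix (Fin 2) (Fin 2) (LocalRing L v)))
  (hSk : ∀ t, t ∈ Sk ↔ (t.map (conjLocal L (IsCMField.complexConj L) v))ᵀ * gramS (Fp L) L v 2 (gramR L e dV hdV dW hdW) + gramS (Fp L) L v 2 (gramR L e dV hdV dW hdW) * t = 0)
  [MeasurableSpace Sk] [BorelSpace Sk]
  (ψc : ↥(unipDeltaLoc L e dV hdV dW hdW v) ≃ₜ Sk) (hψc : ∀ u, (ψc u).1 = blkB (matA (Fp L) L (IsCMField.complexConj L) v 2 (u : UnitaryGroup.localPi L (IsCMField.complexConj L) (2 + 2) (hermD L e dV hdV dW hdW) v)))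
  (ν : Measure ↥(unipDeltaLoc L e dV hdV dW hdW v)) [ν.IsHaarMeasure]
  [MeasurableSpace (v.adicCompletion (Fp L))] [BorelSpace (v.adicCompletion (Fp L))] (μF : Measure (v.adicCompletion (Fp L))) [μF.IsAddHaarMeasure]
  -- the unramified Hecke character and the Fourier index
  (χ : HeckeCharacter L) (hχ : ∀ w : UnitaryGroup.PlacesOver L v, χ.IsUnramifiedAt w.1)
  (hχur : ∀ (w : UnitaryGroup.PlacesOver L v) (x : (w.1.adicCompletion L)ˣ), Valued.v (x : w.1.adicCompletion L) = 1 → χ.localComponent w.1 x = 1)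
  (S : Matrix (Fin 2) (Fin 2) L)
  {β βinv : Matrix (Fin 2) (Fin 2) (LocalRing L v)} (hβdef : β = -(⅟(2 : LocalRing L v) • S.map (algebraMap L (LocalRing L v))))
  (hβs : (β.map (conjLocal L (IsCMField.complexConj L) v))ᵀ * gramS (Fp L) L v 2 (gramR L e dV hdV dW hdW) + gramS (Fp L) L v 2 (gramR L e dV hdV dW hdW) * β = 0) (hββ : β * βinv = 1)
  (hβ0 : ∀ i j (w : UnitaryGroup.PlacesOver L v), Valued.v (β i j w) ≤ Valued.v (toPlace v w π) ^ (0 : ℤ))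
  (hβinv0 : ∀ i j (w : UnitaryGroup.PlacesOver L v), Valued.v (βinv i j w) ≤ Valued.v (toPlace v w π) ^ (0 : ℤ))
  -- the additive character of `L⁺_v`, the local trace, B3's letter
  {ψ : AddChar (v.adicCompletion (Fp L)) Circle} (hψ : Continuous ψ) (hdψ : ψ.HasConductorExp 0)
  {τ : LocalRing L v → v.adicCompletion (Fp L)} (hτ : ∀ r, toLocalRing L v (τ r) = r + conjLocal L (IsCMField.complexConj L) v r) (hτadd : ∀ r s, τ (r + s) = τ r + τ s)
  (hτs : ∀ (z : v.adicCompletion (Fp L)) (r : LocalRing L v), τ (toLocalRing L v z * r) = z * τ r) (hτc : Continuous τ)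
  (hΨ : ∀ x : LocalRing L v, (∏ w : UnitaryGroup.PlacesOver L v, (adeleAddChar L).adicComponent w.1 (x w)) = ψ (τ x))
  -- the good-place letters of ★ E7 at `T₀ := gramR`, `δ := imagUnit L`
  (h2v : ∀ w : UnitaryGroup.PlacesOver L v, ValuativeRel.valuation (w.1.adicCompletion L) (2 : w.1.adicCompletion L) = 1)
  (hT : ∀ (w : UnitaryGroup.PlacesOver L v) (i j : Fin 2),
    ValuativeRel.valuation (w.1.adicCompletion L) (algebraMap L (w.1.adicCompletion L) (algebraMap (Fp L) L (gramR L e dV hdV dW hdW i j))) ≤ 1)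
  (hTinv : ∀ (w : UnitaryGroup.PlacesOver L v) (i j : Fin 2),
    ValuativeRel.valuation (w.1.adicCompletion L) (algebraMap L (w.1.adicCompletion L) (algebraMap (Fp L) L ((gramR L e dV hdV dW hdW)⁻¹ i j))) ≤ 1)
  (hTb : ∀ i j (w : UnitaryGroup.PlacesOver L v), Valued.v (gramS (Fp L) L v 2 (gramR L e dV hdV dW hdW) i j w) ≤ Valued.v (toPlace v w π) ^ (0 : ℤ))
  (hTib : ∀ i j (w : UnitaryGroup.PlacesOver L v), Valued.v ((gramS (Fp L) L v 2 (gramR L e dV hdV dW hdW))⁻¹ i j w) ≤ Valued.v (toPlace v w π) ^ (0 : ℤ))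
  (hϖ0 : ∀ w : UnitaryGroup.PlacesOver L v, toPlace v w π ≠ 0)
  (h2F : Valued.v (2 : v.adicCompletion (Fp L)) = 1)
  {ε₁ : LocalRing L v} (hεσ : conjLocal L (IsCMField.complexConj L) v ε₁ = -ε₁) (hεint : ∀ w : UnitaryGroup.PlacesOver L v, Valued.v (ε₁ w) ≤ 1)
  (hε : ∀ w : UnitaryGroup.PlacesOver L v, Valued.v (toPlace v w π) ^ (0 : ℤ) ≤ Valued.v ((2 * ε₁) w))
  (h2 : ∀ w : UnitaryGroup.PlacesOver L v, Valued.v (toPlace v w π) ^ (0 : ℤ) ≤ Valued.v ((2 : LocalRing L v) w))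
  (w₀ : UnitaryGroup.PlacesOver L v)

/-! ## §1 The local factor of row G1 at a good unimodular place -/

omit [MeasurableSpace (v.adicCompletion (Fp L))] [BorelSpace (v.adicCompletion (Fp L))] in
include hSk hψc in
set_option maxHeartbeats 1200000 in -- MEASURED: farm-direct cost ∈ (400 000, 600 000] (probes 400000 ✗ ∕ 600000 ✓) — the K2Lit doubled unitary datum's binder telescope ×3 (★ B2 through ★ B1), the class of ★ B4's 800 000 decls; scoped 2×, plain `exact`
/-- **THE SKEW-CARRIER MEASURE LETTERS IN THE CM FRAME**: `ψc_*ν` is an additive Haar measure on `Skew` and regular, and `Skew` is locally compact — ★ B2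
`isAddHaarMeasure_map_skew` ∕ `regular_map_skew` ∕ `locallyCompactSpace_skew` at `N′ := unipDeltaLoc v` (★ B1 `mem_unipDeltaLoc_iff_mem_unipDeltaLocal`); packed once so that the
heads below pay the frame telescope a single time. [cite: Weil1965, §37] [cite: Casselman1980, §3] -/
theorem skewCarrier_measure_letters :
    (Measure.map ψc ν).IsAddHaarMeasure ∧ (Measure.map ψc ν).Regular ∧ LocallyCompactSpace Sk := by
  haveI : Algebra.IsQuadraticExtension (Fp L) L := IsCMField.isQuadraticExtension L
  have hN := mem_unipDeltaLoc_iff_mem_unipDeltaLocal L e dV hdV dW hdW v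
  exact ⟨isAddHaarMeasure_map_skew (Fp L) L (IsCMField.complexConj L) v 2 (hermD_eq_map_gramD L e dV hdV dW hdW) hN hSk ψc hψc ν,
    regular_map_skew (Fp L) L (IsCMField.complexConj L) v 2 (hermD_eq_map_gramD L e dV hdV dW hdW) hN hSk ψc hψc ν, locallyCompactSpace_skew (Fp L) L (IsCMField.complexConj L) v 2 hSk⟩

include hdV0 hdW0 hπ hπw hSk hψc μF hχ hχur hβs hββ hβ0 hβinv0 hψ hdψ hτ hτadd hτs hτc h2v hT hTinv hTb hTib h2F hεσ hεint hε h2 in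
set_option maxHeartbeats 800000 in -- MEASURED: farm-direct cost ∈ (200 000, 400 000] (probes 400000 ✓) — ★ file 1's head at the K2Lit CM frame (binder telescope, ★ B4's class); scoped 2×, plain `exact`
/-- **THE SKEW-CARRIER WHITTAKER INTEGRAL OF `Λ_{s,v}` IN THE CM FRAME, INERT PLACE** (raw parity letter `α = −1`): ★ file 1 `integral_whittaker_eq_of_parity_inert` at
`(F, E, c, δ, T₀, JD) := (L⁺, L, c, imagUnit L, gramR, hermD)`, `μ := ψc_*ν` (a regular additive Haar measure on `Skew`, ★ B2 `isAddHaarMeasure_map_skew` ∕ `regular_map_skew`;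
`Skew` locally compact, ★ B2 `locallyCompactSpace_skew`), the spherical family `Λ_{·,v}` (★ `isSphericalSection_lambdaLoc`), `det gramR` a unit (★ `isUnit_det_gram`).
[cite: Shimura1997, §18.1 (18.4)] [cite: Liu2011, §2A (2-10)] [cite: Casselman1980, §3] -/
theorem skew_integral_lambdaLoc_eq_of_parity_inert (hw₀ : IsCMField.complexConj L • w₀.1 = w₀.1)
    (hδu : ∀ w : UnitaryGroup.PlacesOver L v, Valued.v (algebraMap L (LocalRing L v) (imagUnit L) w) = 1)
    (hα : (((∏ w : UnitaryGroup.PlacesOver L v, χ.localComponent w.1 (Units.mk0 (toPlace v w π) (hϖ0 w))) : ℂˣ) : ℂ) = -1)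
    (s : ℂ)
    (hint : Integrable (fun t : Sk => LambdaLoc L e dV hdV dW hdW v χ s (weylDelta (Fp L) L (IsCMField.complexConj L) v 2 (hermD_eq_map_gramD L e dV hdV dW hdW) * nElem (Fp L) L (IsCMField.complexConj L) v 2 (hermD_eq_map_gramD L e dV hdV dW hdW) t.1 ((hSk t.1).1 t.2)) *
      ((ψ (-τ (Matrix.trace (β * t.1))) : Circle) : ℂ)) (Measure.map ψc ν)) :
    ∫ t, LambdaLoc L e dV hdV dW hdW v χ s (weylDelta (Fp L) L (IsCMField.complexConj L) v 2 (hermD_eq_map_gramD L e dV hdV dW hdW) * nElem (Fp L) L (IsCMField.complexConj L) v 2 (hermD_eq_map_gramD L e dV hdV dW hdW) t.1 ((hSk t.1).1 t.2)) *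
      ((ψ (-τ (Matrix.trace (β * t.1))) : Circle) : ℂ) ∂(Measure.map ψc ν) =
      ((Measure.map ψc ν).real {t : Sk | ∀ i j (w : UnitaryGroup.PlacesOver L v), Valued.v (t.1 i j w) ≤ Valued.v (toPlace v w π) ^ (0 : ℤ)} : ℂ) *
        ((1 - (v.residueCard : ℂ) ^ (-(2 * s + 1))) *
          (1 - (((∏ w : UnitaryGroup.PlacesOver L v, χ.localComponent w.1 (Units.mk0 (toPlace v w π) (hϖ0 w))) : ℂˣ) : ℂ) * (v.residueCard : ℂ) ^ (-(2 * s + 2)))) := by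
  haveI : Algebra.IsQuadraticExtension (Fp L) L := IsCMField.isQuadraticExtension L
  obtain ⟨h₁, h₂, h₃⟩ := skewCarrier_measure_letters L e dV hdV dW hdW v Sk hSk ψc hψc ν
  haveI := h₁; haveI := h₂; haveI := h₃
  exact integral_whittaker_eq_of_parity_inert (F := Fp L) (E := L) (c := (IsCMField.complexConj L)) (hcδ := complexConj_imagUnit L) (hδ := imagUnit_ne_zero L)
    (v := v) (hπ := hπ) (hπw := hπw) (hd := imagUnit_mul_self L) (hJD := (hermD_eq_map_gramD L e dV hdV dW hdW)) (w₀ := w₀) (S := Sk) (hS := hSk) (μ := Measure.map ψc ν)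
    (h2v := h2v) (hT := hT) (hTinv := hTinv) (hTb := hTb) (hTib := hTib) (χv := fun w => χ.localComponent w.1) (hχur := hχur) (hϖ0 := hϖ0)
    (hψ := hψ) (hdψ := hdψ) (hτ := hτ) (hτadd := hτadd) (hτs := hτs) (hτc := hτc) (h2F := h2F) (hεσ := hεσ) (hεint := hεint) (hε := hε) (h2 := h2)
    (hβs := hβs) (hββ := hββ) (hβ0 := hβ0) (hβinv0 := hβinv0)
    (hT₀ := gramR_isSymm L e dV hdV dW hdW) (hT₀d := isUnit_det_gram (Fp L) e (isUnit_det_realDiagonal L dV hdV hdV0) (isUnit_det_realDiagonal L dW hdW hdW0))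
    (μF := μF) (φ := fun s' => LambdaLoc L e dV hdV dW hdW v χ s') (hφ := fun s' => isSphericalSection_lambdaLoc L e dV hdV dW hdW v χ s' hχ)
    (hw₀ := hw₀) (hδu := hδu) (hα := hα) (s := s) (hint := hint)

include hdV0 hdW0 hπ hπw hSk hψc μF hχ hχur hβs hββ hβ0 hβinv0 hψ hdψ hτ hτadd hτs hτc h2v hT hTinv hTb hTib h2F hεσ hεint hε h2 in
set_option maxHeartbeats 800000 in -- MEASURED: farm-direct cost ∈ (200 000, 400 000] (probes 400000 ✓) — ★ file 1's head at the K2Lit CM frame (binder telescope, ★ B4's class); scoped 2×, plain `exact`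
/-- **THE SKEW-CARRIER WHITTAKER INTEGRAL OF `Λ_{s,v}` IN THE CM FRAME, SPLIT PLACE** (raw parity letter `α = 1`): ★ file 1 `integral_whittaker_eq_of_parity_split` at
`(F, E, c, δ, T₀, JD) := (L⁺, L, c, imagUnit L, gramR, hermD)`, `μ := ψc_*ν` (a regular additive Haar measure on `Skew`, ★ B2 `isAddHaarMeasure_map_skew` ∕ `regular_map_skew`;
`Skew` locally compact, ★ B2 `locallyCompactSpace_skew`), the spherical family `Λ_{·,v}` (★ `isSphericalSection_lambdaLoc`), `det gramR` a unit (★ `isUnit_det_gram`).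
[cite: Shimura1997, §18.1 (18.4)] [cite: Liu2011, §2A (2-10)] [cite: Casselman1980, §3] -/
theorem skew_integral_lambdaLoc_eq_of_parity_split (hw₀ : IsCMField.complexConj L • w₀.1 ≠ w₀.1)
    (hα : (((∏ w : UnitaryGroup.PlacesOver L v, χ.localComponent w.1 (Units.mk0 (toPlace v w π) (hϖ0 w))) : ℂˣ) : ℂ) = 1)
    (s : ℂ)
    (hint : Integrable (fun t : Sk => LambdaLoc L e dV hdV dW hdW v χ s (weylDelta (Fp L) L (IsCMField.complexConj L) v 2 (hermD_eq_map_gramD L e dV hdV dW hdW) * nElem (Fp L) L (IsCMField.complexConj L) v 2 (hermD_eq_map_gramD L e dV hdV dW hdW) t.1 ((hSk t.1).1 t.2)) *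
      ((ψ (-τ (Matrix.trace (β * t.1))) : Circle) : ℂ)) (Measure.map ψc ν)) :
    ∫ t, LambdaLoc L e dV hdV dW hdW v χ s (weylDelta (Fp L) L (IsCMField.complexConj L) v 2 (hermD_eq_map_gramD L e dV hdV dW hdW) * nElem (Fp L) L (IsCMField.complexConj L) v 2 (hermD_eq_map_gramD L e dV hdV dW hdW) t.1 ((hSk t.1).1 t.2)) *
      ((ψ (-τ (Matrix.trace (β * t.1))) : Circle) : ℂ) ∂(Measure.map ψc ν) =
      ((Measure.map ψc ν).real {t : Sk | ∀ i j (w : UnitaryGroup.PlacesOver L v), Valued.v (t.1 i j w) ≤ Valued.v (toPlace v w π) ^ (0 : ℤ)} : ℂ) *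
        ((1 - (v.residueCard : ℂ) ^ (-(2 * s + 1))) *
          (1 - (((∏ w : UnitaryGroup.PlacesOver L v, χ.localComponent w.1 (Units.mk0 (toPlace v w π) (hϖ0 w))) : ℂˣ) : ℂ) * (v.residueCard : ℂ) ^ (-(2 * s + 2)))) := by
  haveI : Algebra.IsQuadraticExtension (Fp L) L := IsCMField.isQuadraticExtension L
  obtain ⟨h₁, h₂, h₃⟩ := skewCarrier_measure_letters L e dV hdV dW hdW v Sk hSk ψc hψc ν
  haveI := h₁; haveI := h₂; haveI := h₃
  exact integral_whittaker_eq_of_parity_split (F := Fp L) (E := L) (c := (IsCMField.complexConj L)) (hcδ := complexConj_imagUnit L) (hδ := imagUnit_ne_zero L)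
    (v := v) (hπ := hπ) (hπw := hπw) (hd := imagUnit_mul_self L) (hJD := (hermD_eq_map_gramD L e dV hdV dW hdW)) (w₀ := w₀) (S := Sk) (hS := hSk) (μ := Measure.map ψc ν)
    (h2v := h2v) (hT := hT) (hTinv := hTinv) (hTb := hTb) (hTib := hTib) (χv := fun w => χ.localComponent w.1) (hχur := hχur) (hϖ0 := hϖ0)
    (hψ := hψ) (hdψ := hdψ) (hτ := hτ) (hτadd := hτadd) (hτs := hτs) (hτc := hτc) (h2F := h2F) (hεσ := hεσ) (hεint := hεint) (hε := hε) (h2 := h2)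
    (hβs := hβs) (hββ := hββ) (hβ0 := hβ0) (hβinv0 := hβinv0)
    (hT₀ := gramR_isSymm L e dV hdV dW hdW) (hT₀d := isUnit_det_gram (Fp L) e (isUnit_det_realDiagonal L dV hdV hdV0) (isUnit_det_realDiagonal L dW hdW hdW0))
    (μF := μF) (φ := fun s' => LambdaLoc L e dV hdV dW hdW v χ s') (hφ := fun s' => isSphericalSection_lambdaLoc L e dV hdV dW hdW v χ s' hχ)
    (hw₀ := hw₀) (hα := hα) (s := s) (hint := hint)

include hdV0 hdW0 hπ hπw hSk hψc μF hχ hχur hβdef hβs hββ hβ0 hβinv0 hψ hdψ hτ hτadd hτs hτc hΨ h2v hT hTinv hTb hTib h2F hεσ hεint hε h2 in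
set_option maxHeartbeats 1200000 in -- MEASURED: farm-direct cost ∈ (400 000, 600 000] (probes 400000 ✗ ∕ 600000 ✓) — ★ B4 rewrite + ★ B2 volume + the Skew lemma under `↥(unipDeltaLoc v) ≤ H(L⁺_v)` (★ B4's 800 000 class); scoped 2×, plain `rw`∕`exact`
/-- **ROW G1's LOCAL FACTOR AT A GOOD UNIMODULAR INERT PLACE, RAW PARITY LETTER** (`c • w₀ = w₀`, `δ` a unit above `v`, `α := ∏_{w∣v} χ_w(ι_w ϖ) = −1`):
`∫ conj ψ_S(ι_v y)·Λ_{s,v}((w_Δ)_v y) dν = ν(N_Δ ∩ K_v) · ((1 − q_v^{−(2s+1)}) · (1 − α · q_v^{−(2s+2)}))` — ★ B4 ∘ ★ file 1 (inert) ∘ ★ B2.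
[cite: Shimura1997, §18.1 (18.4)] [cite: Liu2011, §2A (2-10)] [cite: Casselman1980, §3] -/
theorem integral_unipDeltaLoc_lambdaLoc_eq_of_parity_inert (hw₀ : IsCMField.complexConj L • w₀.1 = w₀.1)
    (hδu : ∀ w : UnitaryGroup.PlacesOver L v, Valued.v (algebraMap L (LocalRing L v) (imagUnit L) w) = 1)
    (hα : (((∏ w : UnitaryGroup.PlacesOver L v, χ.localComponent w.1 (Units.mk0 (toPlace v w π) (hϖ0 w))) : ℂˣ) : ℂ) = -1)
    (s : ℂ)
    (hint : Integrable (fun t : Sk => LambdaLoc L e dV hdV dW hdW v χ s (weylDelta (Fp L) L (IsCMField.complexConj L) v 2 (hermD_eq_map_gramD L e dV hdV dW hdW) * nElem (Fp L) L (IsCMField.complexConj L) v 2 (hermD_eq_map_gramD L e dV hdV dW hdW) t.1 ((hSk t.1).1 t.2)) *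
      ((ψ (-τ (Matrix.trace (β * t.1))) : Circle) : ℂ)) (Measure.map ψc ν)) :
    ∫ y, conj ((unipDeltaChar L e dV hdV dW hdW S (locToAdelic L e dV hdV dW hdW v (y : UnitaryGroup.localPi L (IsCMField.complexConj L) (2 + 2) (hermD L e dV hdV dW hdW) v)) : Circle) : ℂ) *
        LambdaLoc L e dV hdV dW hdW v χ s (weylDelta (Fp L) L (IsCMField.complexConj L) v 2 (hermD_eq_map_gramD L e dV hdV dW hdW) * (y : UnitaryGroup.localPi L (IsCMField.complexConj L) (2 + 2) (hermD L e dV hdV dW hdW) v)) ∂ν =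
      (ν.real {u : ↥(unipDeltaLoc L e dV hdV dW hdW v) | (u : UnitaryGroup.localPi L (IsCMField.complexConj L) (2 + 2) (hermD L e dV hdV dW hdW) v) ∈ UnitaryGroup.localInt L (IsCMField.complexConj L) (2 + 2) (hermD L e dV hdV dW hdW) v} : ℂ) *
        ((1 - (v.residueCard : ℂ) ^ (-(2 * s + 1))) *
          (1 - (((∏ w : UnitaryGroup.PlacesOver L v, χ.localComponent w.1 (Units.mk0 (toPlace v w π) (hϖ0 w))) : ℂˣ) : ℂ) * (v.residueCard : ℂ) ^ (-(2 * s + 2)))) := by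
  have hN := mem_unipDeltaLoc_iff_mem_unipDeltaLocal L e dV hdV dW hdW v
  rw [integral_unipDeltaLoc_eq_integral_skew_addChar L e dV hdV dW hdW v Sk hSk ψc hψc ν S
    (fun y => LambdaLoc L e dV hdV dW hdW v χ s (weylDelta (Fp L) L (IsCMField.complexConj L) v 2 (hermD_eq_map_gramD L e dV hdV dW hdW) * y)) hΨ, ← hβdef,
    ← measureReal_map_ball_zero_eq (Fp L) L (IsCMField.complexConj L) v 2 (hermD_eq_map_gramD L e dV hdV dW hdW) hπ hN h2v ψc hψc ν]
  exact skew_integral_lambdaLoc_eq_of_parity_inert L e dV hdV dW hdW hdV0 hdW0 v hπ hπw Sk hSk ψc hψc ν μF χ hχ hχur hβs hββ hβ0 hβinv0 hψ hdψ hτ hτadd hτs hτc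
    h2v hT hTinv hTb hTib hϖ0 h2F hεσ hεint hε h2 w₀ hw₀ hδu hα s hint

include hdV0 hdW0 hπ hπw hSk hψc μF hχ hχur hβdef hβs hββ hβ0 hβinv0 hψ hdψ hτ hτadd hτs hτc hΨ h2v hT hTinv hTb hTib h2F hεσ hεint hε h2 in
set_option maxHeartbeats 1200000 in -- MEASURED: farm-direct cost ∈ (400 000, 600 000] (probes 400000 ✗ ∕ 600000 ✓) — ★ B4 rewrite + ★ B2 volume + the Skew lemma under `↥(unipDeltaLoc v) ≤ H(L⁺_v)` (★ B4's 800 000 class); scoped 2×, plain `rw`∕`exact`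
/-- **ROW G1's LOCAL FACTOR AT A GOOD UNIMODULAR SPLIT PLACE, RAW PARITY LETTER** (`c • w₀ ≠ w₀`, `α := ∏_{w∣v} χ_w(ι_w ϖ) = 1`):
`∫ conj ψ_S(ι_v y)·Λ_{s,v}((w_Δ)_v y) dν = ν(N_Δ ∩ K_v) · ((1 − q_v^{−(2s+1)}) · (1 − α · q_v^{−(2s+2)}))` — ★ B4 ∘ ★ file 1 (split) ∘ ★ B2.
[cite: Shimura1997, §18.1 (18.4)] [cite: Liu2011, §2A (2-10)] [cite: Casselman1980, §3] -/
theorem integral_unipDeltaLoc_lambdaLoc_eq_of_parity_split (hw₀ : IsCMField.complexConj L • w₀.1 ≠ w₀.1)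
    (hα : (((∏ w : UnitaryGroup.PlacesOver L v, χ.localComponent w.1 (Units.mk0 (toPlace v w π) (hϖ0 w))) : ℂˣ) : ℂ) = 1)
    (s : ℂ)
    (hint : Integrable (fun t : Sk => LambdaLoc L e dV hdV dW hdW v χ s (weylDelta (Fp L) L (IsCMField.complexConj L) v 2 (hermD_eq_map_gramD L e dV hdV dW hdW) * nElem (Fp L) L (IsCMField.complexConj L) v 2 (hermD_eq_map_gramD L e dV hdV dW hdW) t.1 ((hSk t.1).1 t.2)) *
      ((ψ (-τ (Matrix.trace (β * t.1))) : Circle) : ℂ)) (Measure.map ψc ν)) :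
    ∫ y, conj ((unipDeltaChar L e dV hdV dW hdW S (locToAdelic L e dV hdV dW hdW v (y : UnitaryGroup.localPi L (IsCMField.complexConj L) (2 + 2) (hermD L e dV hdV dW hdW) v)) : Circle) : ℂ) *
        LambdaLoc L e dV hdV dW hdW v χ s (weylDelta (Fp L) L (IsCMField.complexConj L) v 2 (hermD_eq_map_gramD L e dV hdV dW hdW) * (y : UnitaryGroup.localPi L (IsCMField.complexConj L) (2 + 2) (hermD L e dV hdV dW hdW) v)) ∂ν =
      (ν.real {u : ↥(unipDeltaLoc L e dV hdV dW hdW v) | (u : UnitaryGroup.localPi L (IsCMField.complexConj L) (2 + 2) (hermD L e dV hdV dW hdW) v) ∈ UnitaryGroup.localInt L (IsCMField.complexConj L) (2 + 2) (hermD L e dV hdV dW hdW) v} : ℂ) *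
        ((1 - (v.residueCard : ℂ) ^ (-(2 * s + 1))) *
          (1 - (((∏ w : UnitaryGroup.PlacesOver L v, χ.localComponent w.1 (Units.mk0 (toPlace v w π) (hϖ0 w))) : ℂˣ) : ℂ) * (v.residueCard : ℂ) ^ (-(2 * s + 2)))) := by
  have hN := mem_unipDeltaLoc_iff_mem_unipDeltaLocal L e dV hdV dW hdW v
  rw [integral_unipDeltaLoc_eq_integral_skew_addChar L e dV hdV dW hdW v Sk hSk ψc hψc ν S
    (fun y => LambdaLoc L e dV hdV dW hdW v χ s (weylDelta (Fp L) L (IsCMField.complexConj L) v 2 (hermD_eq_map_gramD L e dV hdV dW hdW) * y)) hΨ, ← hβdef,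
    ← measureReal_map_ball_zero_eq (Fp L) L (IsCMField.complexConj L) v 2 (hermD_eq_map_gramD L e dV hdV dW hdW) hπ hN h2v ψc hψc ν]
  exact skew_integral_lambdaLoc_eq_of_parity_split L e dV hdV dW hdW hdV0 hdW0 v hπ hπw Sk hSk ψc hψc ν μF χ hχ hχur hβs hββ hβ0 hβinv0 hψ hdψ hτ hτadd hτs hτc
    h2v hT hTinv hTb hTib hϖ0 h2F hεσ hεint hε h2 w₀ hw₀ hα s hint

include hdV0 hdW0 hπ hπw hSk hψc μF hχ hχur hβdef hβs hββ hβ0 hβinv0 hψ hdψ hτ hτadd hτs hτc hΨ h2v hT hTinv hTb hTib h2F hεσ hεint hε h2 w₀ in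
set_option maxHeartbeats 800000 in -- MEASURED: farm-direct cost ∈ (200 000, 400 000] (probes 200000 ✗ ∕ 400000 ✓) — two applications of the parity heads + `rw` (★ B4's class); scoped 2×, no search tactics
/-- **ROW G2's PER-PLACE GLUE — ROW G1's LOCAL FACTOR AT A GOOD UNIMODULAR PLACE, IN ★ G1's `hW` CURRENCY.**  With the parity letter read through `ε = ε_{L∕L⁺}`
(`hα : ∏_{w∣v} χ_w(ι_w ϖ) = ε(ϖ_v)`, `ε = quadraticHeckeCharCM L`; `χ|_{𝔸_{L⁺}^×} = ε`) and `v` unramified in `L` (`hunr`):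
**`∫ conj ψ_S(ι_v y)·Λ_{s,v}((w_Δ)_v y) dν = ν(N_Δ(L⁺_v) ∩ K_{H,v}) · ((1 − q_v^{−(2s+1)}) · (1 − ε(ϖ_v) · q_v^{−(2s+2)}))`** — the letter `hW` of ★ G1
`K2LiuGoodPlaceWhittakerEulerAssembly.hasProd_whittaker_div_vol` at `v` with `W v :=` the left-hand side and `m v := ν.real (N_Δ ∩ K_v)`.  Case `c • w₀ = w₀`: ★
`valueAtUniformizer_quadraticHeckeCharCM_of_nonsplit` (`ε(ϖ_v) = −1`) + the inert head; case `c • w₀ ≠ w₀`: ★ `…_of_split` (`ε(ϖ_v) = 1`) + the split head.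
[cite: Liu2011, §2A (2-10)] [cite: Shimura1997, §18.1 (18.4)] [cite: KudlaRallis1994, §1] -/
theorem integral_unipDeltaLoc_lambdaLoc_eq
    (hδu : ∀ w : UnitaryGroup.PlacesOver L v, Valued.v (algebraMap L (LocalRing L v) (imagUnit L) w) = 1)
    (hunr : Algebra.IsUnramifiedIn (𝓞 L) v.asIdeal)
    (hα : (((∏ w : UnitaryGroup.PlacesOver L v, χ.localComponent w.1 (Units.mk0 (toPlace v w π) (hϖ0 w))) : ℂˣ) : ℂ) = (quadraticHeckeCharCM L).valueAtUniformizer v)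
    (s : ℂ)
    (hint : Integrable (fun t : Sk => LambdaLoc L e dV hdV dW hdW v χ s (weylDelta (Fp L) L (IsCMField.complexConj L) v 2 (hermD_eq_map_gramD L e dV hdV dW hdW) * nElem (Fp L) L (IsCMField.complexConj L) v 2 (hermD_eq_map_gramD L e dV hdV dW hdW) t.1 ((hSk t.1).1 t.2)) *
      ((ψ (-τ (Matrix.trace (β * t.1))) : Circle) : ℂ)) (Measure.map ψc ν)) :
    ∫ y, conj ((unipDeltaChar L e dV hdV dW hdW S (locToAdelic L e dV hdV dW hdW v (y : UnitaryGroup.localPi L (IsCMField.complexConj L) (2 + 2) (hermD L e dV hdV dW hdW) v)) : Circle) : ℂ) *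
        LambdaLoc L e dV hdV dW hdW v χ s (weylDelta (Fp L) L (IsCMField.complexConj L) v 2 (hermD_eq_map_gramD L e dV hdV dW hdW) * (y : UnitaryGroup.localPi L (IsCMField.complexConj L) (2 + 2) (hermD L e dV hdV dW hdW) v)) ∂ν =
      (ν.real {u : ↥(unipDeltaLoc L e dV hdV dW hdW v) | (u : UnitaryGroup.localPi L (IsCMField.complexConj L) (2 + 2) (hermD L e dV hdV dW hdW) v) ∈ UnitaryGroup.localInt L (IsCMField.complexConj L) (2 + 2) (hermD L e dV hdV dW hdW) v} : ℂ) *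
        ((1 - (v.residueCard : ℂ) ^ (-(2 * s + 1))) *
          (1 - (quadraticHeckeCharCM L).valueAtUniformizer v * (v.residueCard : ℂ) ^ (-(2 * s + 2)))) := by
  by_cases hw₀ : IsCMField.complexConj L • w₀.1 = w₀.1
  · have hεv : (quadraticHeckeCharCM L).valueAtUniformizer v = -1 := valueAtUniformizer_quadraticHeckeCharCM_of_nonsplit L v w₀ hw₀ hunr
    have h := integral_unipDeltaLoc_lambdaLoc_eq_of_parity_inert L e dV hdV dW hdW hdV0 hdW0 v hπ hπw Sk hSk ψc hψc ν μF χ hχ hχur S hβdef hβs hββ hβ0 hβinv0 hψ hdψ hτ hτadd hτs hτc hΨ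
      h2v hT hTinv hTb hTib hϖ0 h2F hεσ hεint hε h2 w₀ hw₀ hδu (hα.trans hεv) s hint
    rw [hα.trans hεv] at h
    rw [hεv]
    exact h
  · have hεv : (quadraticHeckeCharCM L).valueAtUniformizer v = 1 := valueAtUniformizer_quadraticHeckeCharCM_of_split L v w₀ hw₀
    have h := integral_unipDeltaLoc_lambdaLoc_eq_of_parity_split L e dV hdV dW hdW hdV0 hdW0 v hπ hπw Sk hSk ψc hψc ν μF χ hχ hχur S hβdef hβs hββ hβ0 hβinv0 hψ hdψ hτ hτadd hτs hτc hΨ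
      h2v hT hTinv hTb hTib hϖ0 h2F hεσ hεint hε h2 w₀ hw₀ (hα.trans hεv) s hint
    rw [hα.trans hεv] at h
    rw [hεv]
    exact h

end Summit.HodgeConjecture.HodgeConjecture.Cruxes.HLiu418.K2LiuGoodPlaceLocalFactor

end
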